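import Literature.Barriers.ValiantsHypothesis.NotViaSaturationsChowProofs
import Literature.Computability.AlgebraicComplexity.HwvIdealRankBound
import Literature.Computability.AlgebraicComplexity.OrbitMultiplicitySemigroup
import Literature.Computability.AlgebraicComplexity.PowerSumLowDegreeIdeal
import HarnessLib

/-!
# Inheritance: orbit-closure multiplicities do not depend on the ambient space (BLMW 2011 Prop. 6.3.2)

Topic `Computability/AlgebraicComplexity` (geometric complexity theory). Vocabulary of
`OrbitCoordinateRing.lean`, `GLHighestWeight.lean`, `SchurWeylPlethysm.lean`: for a polynomial
`f ∈ k[x_σ]` and a degree `m`, `k[Δ_m(f)] = k[Sym^m k^σ] ⧸ I(GL_σ · f)` (`OrbitCoordRing f m`,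
`orbitVanishingIdeal f m`) with its `GL_σ`-action `orbitCoordRep f m`; `orbitMultiplicity k f m χ`
is the dimension of the space of highest-weight vectors of weight `χ` (upper triangular Borel for
the linear order on `σ`), `plethysmCoeff k σ m χ` the same for the ambient `k[Sym^m k^σ]`
(`coordRep σ k m`).

**The theorem (Bürgisser–Landsberg–Manivel–Weyman, SIAM J. Comput. 40 (2011), Prop. 6.3.2
= arXiv:0907.2850v3 `\label{coordbootprop}`; the special case `W = W' ⊕ W''`,
`K = GL(W') × GL(W'')` of Mulmuley–Sohoni, GCT II, SIAM J. Comput. 38 (2008), Thm. 8.2(1), as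
BLMW remark after the proof):** "Let `W' ⊂ W` be a subspace of dimension `b` and let `f ∈ S^dW'`.
Assume that the coordinate ring of the orbit closure `\overline{GL(W')·f} ⊂ S^dW'` has the
`GL(W')`-decomposition `ℂ[\overline{GL(W')·f}] = ⊕_{π, ℓ(π) ≤ b} (S_πW'^*)^{⊕ m(π)}`. Then the
coordinate ring of the orbit closure `\overline{GL(W)·f} ⊂ S^dW` has the `GL(W)`-decomposition
`ℂ[\overline{GL(W)·f}] = ⊕_{π, ℓ(π) ≤ b} (S_πW^*)^{⊕ m(π)}`." BLMW apply it (end of §6.3) to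
`x = ℓ^{n-m} per_m ∈ S^n ℂ^{m²+1} = W' ⊂ W = ℂ^{n²}`: "[it] reduces the problem of determining
`ℂ[\overline{GL(W)·ℓ^{n-m}per_m}]` to determining `ℂ[\overline{GL(W')·ℓ^{n-m}per_m}]`."

**In the tree's letters.** `ι : σ → τ` is a strictly monotone map of finite linearly ordered
letter types whose range is an upper set (`k^σ = W'` the span of the greatest `|σ|` coordinates of
`W = k^τ`, compatible upper triangular Borel subgroups); `p ∈ k[x_σ]`, `rename ι p ∈ k[x_τ]` the
same polynomial in the big ring; weights `χ : Weight σ` extend by zero to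
`Function.extend ι χ 0 : Weight τ` (for a partition `λ` with `ℓ(λ) ≤ |σ|` this carries the dual
weight `λ^*` of `GL_σ` to the dual weight `λ^*` of `GL_τ`, `dualOfPartition_eq_extend_topEmb`).

* `orbitMultiplicity_rename_extend` (characteristic zero, `m ≠ 0`):
  `mult_{χ̂} k[Δ_m(ι p)] = mult_χ k[Δ_m(p)]` — BLMW's `m(π)` is the same in `W'` and `W`;
* `orbitMultiplicity_rename_eq_zero_of_apply_ne_zero` / `apply_eq_zero_of_hasHighestWeight_orbitCoordRep_rename`:
  weights of `GL_τ` not vanishing off `range ι` (types `π` with `ℓ(π) > |σ|`) do not occur —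
  BLMW's "`\overline{GL(W)·f} ⊂ Sub_b(S^dW)`", here from the tree's BIP Thm. 4.9(1)
  (`apply_eq_zero_of_hasHighestWeight_orbitCoordRep_of_vars_subset`);
* `orbitMultiplicity_rename_eq`: both clauses as one formula;
* `plethysmCoeff_extend`, `plethysmCoeffOfPartition_eq_of_card_parts_le`: the ambient multiplicities
  (plethysm coefficients `mult(S_π V, S^d(S^m V))`) do not depend on `dim V ≥ ℓ(π)` (infinite field);
* partition / `Fin` form on the last `K` of `N` variables (`topEmb`):
  `orbitMultiplicity_rename_topEmb_dualOfPartition`, `hasHighestWeight_orbitCoordRep_rename_topEmb_iff`.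

**Proof** (BLMW's, made multiplicity-exact; elementary, no desingularisation): by the tree's
rank–nullity identity `mult_χ + dim(HWV_χ ∩ I(GL·f)) = a_χ` (`HwvIdealRankBound.lean`) on both
sides it suffices that renaming of coordinate polynomials along `ι` (an injective algebra map
`k[Sym^m k^σ] → k[Sym^m k^τ]`) maps (§4) the highest-weight vectors of weight `χ` ONTO those of
weight `χ̂` ("the two modules have the same highest weight vector", Landsberg 2017 §8.3.3; `⊆` is the
tree's `rename_mem_highestWeightSpace_coordRep` from `NotViaSaturationsChowProofs.lean`, `⊇` is a
torus-weight computation: every monomial of a weight vector of weight `χ̂` involves only coordinates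
of monomials in the `ι`-variables, and highest-weight-ness descends along the block-diagonal
extension `extendGL : GL_σ → GL_τ`, §1), and (§3) the equations onto the equations:
`F ∈ I(GL_σ·p) ↔ ι F ∈ I(GL_τ·ι p)` for ANY injective `ι` over an infinite field — "`p(h) = p(h₁)`
and `h ∈ GL(W)·f` iff `h₁ ∈ GL(W')·f`" in BLMW's proof; precisely, the `W'`-part of `g · ι p` is
the substitution of the `σ`-block of `g`, a point of the ENDOMORPHISM orbit `End(k^σ)·p`, on
which `I(GL_σ·p)` vanishes (`aeval_formCoeff_linSubst_eq_zero_of_mem_orbitVanishingIdeal`, density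
of `GL` in `End`).

Written for the GCT multiplicity-obstruction engine (cell `pub-gct`, bundle
papers/PneNP/gct-obstructions; ENGINE.md §1.5 "Inheritance": all permanent-side work for `per_n`
padded into `m × m` matrices lives in `GL_{n²+1}`; completeness of a screen over `GL_{n²+1}`-points).
Honest framing of that cell: rung-1 multiplicity-obstruction search for permanent versus
determinant at small `(n, m)`; no claim about VP ≠ VNP or P ≠ NP. No named facts; the auxiliary
definitions `extendMatrix`, `extendMatrixMonoidHom`, `extendGL`, `topEmb` are proof devices.

## References

* [BurgisserEtAl2011] P. Bürgisser, J. M. Landsberg, L. Manivel, J. Weyman, *An overview of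
  mathematical issues arising in the geometric complexity theory approach to VP ≠ VNP*, SIAM J.
  Comput. 40(4) (2011) 1179–1209 = arXiv:0907.2850v3, §6.3 Prop. 6.3.2 (label `coordbootprop`,
  TeX ll. 1606–1634) and the Remark following it; §6.1 Thm. 6.1.5 = [MS2, Thm. 8.2].
* [MulmuleySohoni2008] K. Mulmuley, M. Sohoni, *Geometric complexity theory II*, SIAM J. Comput.
  38(3) (2008) 1175–1206, Thm. 8.2 (as restated in BLMW Thm. 6.1.5).
* [Landsberg2017] J. M. Landsberg, *Geometry and Complexity Theory*, CUP 2017, §8.3.3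
  (inheritance), Prop. 8.4.1.1 (`Sub_k`).
* [BurgisserIkenmeyerPanovaJAMS2019] P. Bürgisser, C. Ikenmeyer, G. Panova, J. AMS 32 (2019),
  Thm. 4.9(1) (tree: `OrbitClosureWeights.lean`).
-/

noncomputable section

open MvPolynomial

namespace Literature.Computability.AlgebraicComplexity

open _root_.Literature.NumberTheory.DiophantineGeometry
open _root_.Literature.Barriers.ValiantsHypothesis (upperBlock upperBlock_apply degIdxMap degIdxMap_val
  degIdxMap_injective exists_eq_degIdxMap coordSubst_rename_degIdxMap
  rename_mem_highestWeightSpace_coordRep isUpperTriangular_upperBlock weightChar_upperBlock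
  killCompl_X_app killCompl_X_of_not_mem sum_eq_sum_app lt_app_of_not_mem_range)

variable {k : Type*} [Field k] {σ τ : Type*} [Fintype σ] [LinearOrder σ] [Fintype τ]
  [LinearOrder τ] {ι : σ → τ}

/-! ### §1 The block-diagonal extension `GL_σ → GL_τ` along `ι` -/

section Extend

/-- The block-diagonal extension of a `σ × σ` matrix `c` to a `τ × τ` matrix along the injection
`ι`: `c` on the block `range ι × range ι`, the identity on the complementary diagonal, `0`
elsewhere. [folklore] -/
def extendMatrix (hι : Function.Injective ι) (c : Matrix σ σ k) : Matrix τ τ k :=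
  Matrix.of fun x y =>
    if hx : x ∈ Set.range ι then
      (if hy : y ∈ Set.range ι then
        c ((Equiv.ofInjective ι hι).symm ⟨x, hx⟩) ((Equiv.ofInjective ι hι).symm ⟨y, hy⟩) else 0)
    else (if x = y then 1 else 0)

omit [LinearOrder σ] [Fintype τ] in
/-- Unfolding of `extendMatrix`. [folklore] -/
theorem extendMatrix_apply (hι : Function.Injective ι) (c : Matrix σ σ k) (x y : τ) :
    extendMatrix hι c x y = if hx : x ∈ Set.range ι then
      (if hy : y ∈ Set.range ι then
        c ((Equiv.ofInjective ι hι).symm ⟨x, hx⟩) ((Equiv.ofInjective ι hι).symm ⟨y, hy⟩) else 0)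
    else (if x = y then 1 else 0) :=
  rfl

omit [LinearOrder σ] [Fintype τ] in
/-- Entries of the extension on the block. [folklore] -/
@[simp]
theorem extendMatrix_app_app (hι : Function.Injective ι) (c : Matrix σ σ k) (i j : σ) :
    extendMatrix hι c (ι i) (ι j) = c i j := by
  rw [extendMatrix_apply, dif_pos ⟨i, rfl⟩, dif_pos ⟨j, rfl⟩, Equiv.ofInjective_symm_apply,
    Equiv.ofInjective_symm_apply]

omit [LinearOrder σ] [Fintype τ] in
/-- Entries of the extension: block row, column off the block. [folklore] -/
theorem extendMatrix_app_of_not_mem (hι : Function.Injective ι) (c : Matrix σ σ k) (i : σ)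
    {y : τ} (hy : y ∉ Set.range ι) : extendMatrix hι c (ι i) y = 0 := by
  rw [extendMatrix_apply, dif_pos ⟨i, rfl⟩, dif_neg hy]

omit [LinearOrder σ] [Fintype τ] in
/-- Entries of the extension off the block rows: the identity. [folklore] -/
theorem extendMatrix_of_not_mem (hι : Function.Injective ι) (c : Matrix σ σ k) {x : τ}
    (hx : x ∉ Set.range ι) (y : τ) : extendMatrix hι c x y = if x = y then 1 else 0 := by
  rw [extendMatrix_apply, dif_neg hx]

omit [LinearOrder σ] [Fintype τ] in
/-- Entries of the extension: row off the block, column on the block. [folklore] -/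
theorem extendMatrix_of_not_mem_app (hι : Function.Injective ι) (c : Matrix σ σ k) {x : τ}
    (hx : x ∉ Set.range ι) (j : σ) : extendMatrix hι c x (ι j) = 0 := by
  rw [extendMatrix_of_not_mem hι c hx, if_neg]
  rintro rfl
  exact hx ⟨j, rfl⟩

omit [LinearOrder σ] [Fintype τ] in
/-- The block of the extension is the original matrix. [folklore] -/
@[simp]
theorem submatrix_extendMatrix (hι : Function.Injective ι) (c : Matrix σ σ k) :
    (extendMatrix hι c).submatrix ι ι = c := by
  ext i j
  rw [Matrix.submatrix_apply, extendMatrix_app_app]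

omit [Fintype τ] in
/-- The extension of the identity is the identity. [folklore] -/
theorem extendMatrix_one (hι : Function.Injective ι) :
    extendMatrix hι (1 : Matrix σ σ k) = 1 := by
  ext x y
  by_cases hx : x ∈ Set.range ι
  · obtain ⟨i, rfl⟩ := hx
    by_cases hy : y ∈ Set.range ι
    · obtain ⟨j, rfl⟩ := hy
      rw [extendMatrix_app_app]
      by_cases hij : i = j
      · rw [hij, Matrix.one_apply_eq, Matrix.one_apply_eq]
      · rw [Matrix.one_apply_ne hij, Matrix.one_apply_ne fun h => hij (hι h)]
    · rw [extendMatrix_app_of_not_mem hι _ i hy, Matrix.one_apply_ne]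
      rintro rfl
      exact hy ⟨i, rfl⟩
  · rw [extendMatrix_of_not_mem hι _ hx, Matrix.one_apply]

omit [LinearOrder σ] in
/-- The extension is multiplicative. [folklore] -/
theorem extendMatrix_mul (hι : Function.Injective ι) (b c : Matrix σ σ k) :
    extendMatrix hι (b * c) = extendMatrix hι b * extendMatrix hι c := by
  ext x z
  rw [Matrix.mul_apply]
  by_cases hx : x ∈ Set.range ι
  · obtain ⟨i, rfl⟩ := hx
    rw [sum_eq_sum_app hι _ fun y hy => by rw [extendMatrix_app_of_not_mem hι b i hy, zero_mul]]
    by_cases hz : z ∈ Set.range ι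
    · obtain ⟨l, rfl⟩ := hz
      simp only [extendMatrix_app_app, Matrix.mul_apply]
    · simp only [extendMatrix_app_of_not_mem hι _ _ hz, mul_zero, Finset.sum_const_zero]
  · have hsum : ∑ y, extendMatrix hι b x y * extendMatrix hι c y z = extendMatrix hι c x z := by
      rw [Finset.sum_eq_single x]
      · rw [extendMatrix_of_not_mem hι b hx, if_pos rfl, one_mul]
      · intro y _ hyx
        rw [extendMatrix_of_not_mem hι b hx, if_neg (Ne.symm hyx), zero_mul]
      · intro h
        exact absurd (Finset.mem_univ x) h
    rw [hsum, extendMatrix_of_not_mem hι _ hx, extendMatrix_of_not_mem hι _ hx]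

variable (k) in
/-- The block-diagonal extension as a monoid homomorphism `Mat_σ → Mat_τ`. [folklore] -/
def extendMatrixMonoidHom (hι : Function.Injective ι) : Matrix σ σ k →* Matrix τ τ k where
  toFun := extendMatrix hι
  map_one' := extendMatrix_one hι
  map_mul' := extendMatrix_mul hι

variable (k) in
/-- The block-diagonal extension `GL_σ → GL_τ` along `ι` (a group homomorphism). [folklore] -/
def extendGL (hι : Function.Injective ι) : GL σ k →* GL τ k :=
  Units.map (extendMatrixMonoidHom k hι)

/-- The matrix of `extendGL g` is the extension of the matrix of `g`. [folklore] -/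
@[simp]
theorem coe_extendGL (hι : Function.Injective ι) (g : GL σ k) :
    ((extendGL k hι g : GL τ k) : Matrix τ τ k) = extendMatrix hι (g : Matrix σ σ k) :=
  rfl

/-- Along a strictly monotone `ι`, the extension of an upper triangular matrix is upper
triangular. [folklore] -/
theorem isUpperTriangular_extendGL (hι : StrictMono ι)
    {b : GL σ k} (hb : IsUpperTriangular b) : IsUpperTriangular (extendGL k hι.injective b) := by
  intro x y hyx
  rw [coe_extendGL]
  by_cases hx : x ∈ Set.range ι
  · obtain ⟨i, rfl⟩ := hx
    by_cases hy : y ∈ Set.range ι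
    · obtain ⟨j, rfl⟩ := hy
      rw [extendMatrix_app_app]
      exact hb.apply_eq_zero (hι.lt_iff_lt.mp hyx)
    · exact extendMatrix_app_of_not_mem _ _ i hy
  · rw [extendMatrix_of_not_mem _ _ hx, if_neg]
    rintro rfl
    exact lt_irrefl _ hyx

/-- The `σ`-block of the extension of an upper triangular `b` is `b`. [folklore] -/
theorem upperBlock_extendGL (hι : StrictMono ι) (hup : IsUpperSet (Set.range ι))
    {b : GL σ k} (hb : IsUpperTriangular b) :
    upperBlock hι hup (extendGL k hι.injective b) (isUpperTriangular_extendGL hι hb) = b :=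
  Units.ext (Matrix.ext fun i j => by rw [upperBlock_apply, coe_extendGL, extendMatrix_app_app])

end Extend

/-! ### §2 Substitutions, renaming along `ι`, and killing the variables off `range ι` -/

section Subst

omit [LinearOrder σ] in
/-- **The extension acts on renamed polynomials by the renamed action**:
`(ext c) · ι(p) = ι(c · p)`. [folklore] -/
theorem linSubst_extendMatrix_rename (hι : Function.Injective ι)
    (c : Matrix σ σ k) (p : MvPolynomial σ k) :
    linSubst τ k (extendMatrix hι c) (rename ι p) = rename ι (linSubst σ k c p) := by
  suffices h : (linSubst τ k (extendMatrix hι c)).comp (rename ι) =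
      (rename ι).comp (linSubst σ k c) from congrArg (fun φ => φ p) h
  apply MvPolynomial.algHom_ext
  intro j
  simp only [AlgHom.comp_apply, rename_X, linSubst_X, map_sum, map_smul]
  rw [sum_eq_sum_app hι _ fun y hy => by rw [extendMatrix_of_not_mem_app hι c hy, zero_smul]]
  simp only [extendMatrix_app_app]

omit [LinearOrder σ] [LinearOrder τ] in
/-- **Killing the variables off `range ι` after an ARBITRARY substitution into a polynomial in the
`ι`-variables is substituting the `σ`-block**: `kill(A · ι(p)) = A|_{ι×ι} · p` (the variables of
`ι(p)` go to combinations of all variables; killing keeps the `range ι` part). [folklore] -/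
theorem killCompl_linSubst_rename (hι : Function.Injective ι) (A : Matrix τ τ k)
    (p : MvPolynomial σ k) :
    killCompl hι (linSubst τ k A (rename ι p)) = linSubst σ k (A.submatrix ι ι) p := by
  suffices h : ((killCompl hι).comp (linSubst τ k A)).comp (rename ι) =
      linSubst σ k (A.submatrix ι ι) from congrArg (fun φ => φ p) h
  apply MvPolynomial.algHom_ext
  intro j
  simp only [AlgHom.comp_apply, rename_X, linSubst_X, map_sum, map_smul]
  rw [sum_eq_sum_app hι _ fun y hy => by rw [killCompl_X_of_not_mem hι hy, smul_zero]]
  simp only [killCompl_X_app, Matrix.submatrix_apply]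

variable {m : ℕ}

/-- Degree-`m` coefficients after killing the variables off `range ι` are the coefficients at the
renamed monomials. [folklore] -/
theorem formCoeff_killCompl (hι : Function.Injective ι)
    (Q : MvPolynomial τ k) :
    formCoeff m (killCompl hι Q) = formCoeff m Q ∘ degIdxMap hι := by
  funext d
  change coeff d.1 (killCompl hι Q) = coeff (degIdxMap hι d).1 Q
  rw [degIdxMap_val]
  exact coeff_killCompl hι

/-- **Evaluating a renamed coordinate polynomial**: `(ι F)(Q) = F(kill Q)` on degree-`m`
coefficient vectors. [folklore] -/
theorem aeval_formCoeff_rename_degIdxMap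
    (hι : Function.Injective ι) (Q : MvPolynomial τ k) (F : MvPolynomial (DegIdx σ m) k) :
    aeval (formCoeff m Q) (rename (degIdxMap hι) F) = aeval (formCoeff m (killCompl hι Q)) F := by
  rw [aeval_rename, formCoeff_killCompl]

/-- In particular `(ι F)(ι q) = F(q)`. [folklore] -/
theorem aeval_formCoeff_rename_rename_degIdxMap
    (hι : Function.Injective ι) (q : MvPolynomial σ k) (F : MvPolynomial (DegIdx σ m) k) :
    aeval (formCoeff m (rename ι q)) (rename (degIdxMap hι) F) = aeval (formCoeff m q) F := by
  rw [aeval_formCoeff_rename_degIdxMap, killCompl_rename_app]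

end Subst

/-! ### §3 Equations of the two orbit closures correspond (any injective renaming) -/

section Ideal

variable {m : ℕ}

/-- **Renamed equations.** Over an infinite field, for any injective renaming of variables `ι` and
any `p ∈ k[x_σ]`: a polynomial `F` in the degree-`m` coefficients vanishes on the orbit
`GL_σ · p` iff its renaming vanishes on the orbit `GL_τ · ι(p)`. (`⇐`: the orbit `GL_σ · p`
renames into `GL_τ · ι(p)` through the block-diagonal extension `extendGL`; `⇒`: at a point
`g · ι(p)`, `g ∈ GL_τ`, the renamed `F` only reads the `range ι` part `g|_{ι×ι} · p`, a point of
the ENDOMORPHISM orbit of `p`, on which `I(GL_σ · p)` vanishes by density of `GL_σ` in `Mat_σ`,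
`aeval_formCoeff_linSubst_eq_zero_of_mem_orbitVanishingIdeal`.) This is the step "that it vanishes
on `GL(W) · f` implies it vanishes on `GL(W') · f`" of BLMW's proof.
[cite: BurgisserEtAl2011, Prop. 6.3.2 (proof)] -/
theorem rename_mem_orbitVanishingIdeal_rename_iff [Infinite k] (hι : Function.Injective ι)
    (p : MvPolynomial σ k) (F : MvPolynomial (DegIdx σ m) k) :
    rename (degIdxMap hι) F ∈ orbitVanishingIdeal (rename ι p) m ↔
      F ∈ orbitVanishingIdeal p m := by
  constructor
  · intro h
    rw [mem_orbitVanishingIdeal_iff]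
    intro g
    have h1 := mem_orbitVanishingIdeal_iff.mp h (extendGL k hι g)
    rwa [linSubstRep_apply, coe_extendGL, linSubst_extendMatrix_rename,
      aeval_formCoeff_rename_rename_degIdxMap, ← linSubstRep_apply] at h1
  · intro h
    rw [mem_orbitVanishingIdeal_iff]
    intro g
    rw [aeval_formCoeff_rename_degIdxMap, linSubstRep_apply, killCompl_linSubst_rename]
    exact aeval_formCoeff_linSubst_eq_zero_of_mem_orbitVanishingIdeal h _

end Ideal

/-! ### §4 Highest-weight vectors of a weight extended by zero are renamed highest-weight vectors -/

section Weights

variable {m : ℕ}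

/-- **A torus weight vector of `k[Sym^m k^τ]` is the sum of its monomials of that torus weight**
(infinite field): from the tree's `sum_aeval_monomial_filter_monWeight_eq` at every point and
`MvPolynomial.funext`. Fulton–Harris §15.5. [folklore] -/
theorem eq_sum_filter_monWeight_of_mem_weightSpace [Infinite k] {ψ : Weight τ}
    {G : MvPolynomial (DegIdx τ m) k} (hG : G ∈ weightSpace (coordRep τ k m) ψ) :
    G = ∑ s ∈ G.support.filter (fun s => monWeight s = ψ), monomial s (coeff s G) := by
  apply MvPolynomial.funext
  intro x
  have h := sum_aeval_monomial_filter_monWeight_eq G ψ x fun t ht => by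
    rw [(mem_weightSpace_iff _ _ _).mp hG t ht, map_smul, smul_eq_mul]
  change aeval x G = aeval x _
  rw [map_sum]
  exact h.symm

/-- Hence **every monomial of a torus weight vector has that torus weight**. [folklore] -/
theorem monWeight_eq_of_mem_support [Infinite k] {ψ : Weight τ}
    {G : MvPolynomial (DegIdx τ m) k} (hG : G ∈ weightSpace (coordRep τ k m) ψ)
    {s : DegIdx τ m →₀ ℕ} (hs : s ∈ G.support) : monWeight s = ψ := by
  have hc : coeff s G ≠ 0 := mem_support_iff.mp hs
  have h := congrArg (coeff s) (eq_sum_filter_monWeight_of_mem_weightSpace hG)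
  rw [coeff_sum] at h
  simp only [coeff_monomial, Finset.sum_ite_eq', Finset.mem_filter] at h
  by_contra hne
  rw [if_neg (fun hmem => hne hmem.2)] at h
  exact hc h

/-- If the torus weight of a monomial `∏ X_d^{s(d)}` vanishes at the letter `x`, then `x` occurs in
no coordinate `d` of the monomial. [folklore] -/
theorem apply_eq_zero_of_monWeight_apply_eq_zero (s : DegIdx τ m →₀ ℕ) {x : τ}
    (h : monWeight s x = 0) {d : DegIdx τ m} (hd : d ∈ s.support) : d.1 x = 0 := by
  rw [monWeight_apply, neg_eq_zero, Nat.cast_eq_zero] at h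
  have h1 := Finset.sum_eq_zero_iff.mp h d hd
  exact (Nat.mul_eq_zero.mp h1).resolve_left (Finsupp.mem_support_iff.mp hd)

/-- **A torus weight vector whose weight vanishes off `range ι` is a renamed polynomial**: all its
coordinates `X_E` have `E` supported in the `ι`-variables. [folklore] -/
theorem exists_rename_degIdxMap_eq_of_mem_weightSpace [Infinite k] (hι : Function.Injective ι)
    {ψ : Weight τ} (hψ : ∀ x, x ∉ Set.range ι → ψ x = 0)
    {G : MvPolynomial (DegIdx τ m) k} (hG : G ∈ weightSpace (coordRep τ k m) ψ) :
    ∃ F : MvPolynomial (DegIdx σ m) k, rename (degIdxMap hι) F = G := by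
  apply exists_rename_eq_of_vars_subset_range G (degIdxMap hι) (degIdxMap_injective hι)
  intro E hE
  rw [Finset.mem_coe, mem_vars_iff_mem_support] at hE
  obtain ⟨s, hs, hEs⟩ := hE
  have hw := monWeight_eq_of_mem_support hG hs
  obtain ⟨e, he⟩ := exists_eq_degIdxMap hι (E := E) fun x hx => by
    by_contra hxr
    have h0 := apply_eq_zero_of_monWeight_apply_eq_zero s (by rw [hw, hψ x hxr]) hEs
    exact (Finsupp.mem_support_iff.mp (Finset.mem_coe.mp hx)) h0
  exact ⟨e, he⟩

omit [Fintype σ] [LinearOrder σ] [Fintype τ] [LinearOrder τ] in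
/-- A weight extended by zero along `ι` vanishes off `range ι`. [folklore] -/
theorem extend_apply_of_not_mem_range (χ : Weight σ) {x : τ} (hx : x ∉ Set.range ι) :
    Function.extend ι χ 0 x = 0 := by
  rw [Function.extend_apply' _ _ _ fun ⟨j, hj⟩ => hx ⟨j, hj⟩, Pi.zero_apply]

/-- **Descent of highest-weight vectors**: if the renaming of `F ∈ k[Sym^m k^σ]` along `ι` (strictly
monotone onto an upper set) is a highest-weight vector of `k[Sym^m k^τ]` of weight `χ` extended by
zero, then `F` is a highest-weight vector of weight `χ` (test against the block-diagonal extensions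
of the upper triangular `b ∈ GL_σ`, which are upper triangular with `σ`-block `b`).
[cite: BurgisserEtAl2011, Prop. 6.3.2 (proof)] -/
theorem mem_highestWeightSpace_of_rename_mem (hι : StrictMono ι) (hup : IsUpperSet (Set.range ι))
    {χ : Weight σ} {F : MvPolynomial (DegIdx σ m) k}
    (h : rename (degIdxMap hι.injective) F ∈
      highestWeightSpace (coordRep τ k m) (Function.extend ι χ 0)) :
    F ∈ highestWeightSpace (coordRep σ k m) χ := by
  intro b hb
  apply rename_injective _ (degIdxMap_injective hι.injective)
  have hB := isUpperTriangular_extendGL (k := k) hι hb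
  have h1 := h (extendGL k hι.injective b) hB
  rw [coordRep_apply, coordSubst_rename_degIdxMap hι hup _ hB, ← weightChar_upperBlock hι hup χ _ hB,
    upperBlock_extendGL hι hup hb, ← coordRep_apply] at h1
  rw [map_smul]
  exact h1

/-- **Inheritance of highest-weight vectors, as an equality of spaces** (infinite field; `ι`
strictly monotone onto an upper set): the highest-weight vectors of `k[Sym^m k^τ]` of weight `χ`
extended by zero are exactly the renamings of the highest-weight vectors of `k[Sym^m k^σ]` of
weight `χ` — "the two modules have the same highest weight vector" (Landsberg 2017 §8.3.3).
[cite: BurgisserEtAl2011, Prop. 6.3.2 (proof)] -/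
theorem highestWeightSpace_extend_eq_map [Infinite k] (hι : StrictMono ι)
    (hup : IsUpperSet (Set.range ι)) (χ : Weight σ) :
    highestWeightSpace (coordRep τ k m) (Function.extend ι χ 0) =
      (highestWeightSpace (coordRep σ k m) χ).map
        (rename (degIdxMap hι.injective) :
          MvPolynomial (DegIdx σ m) k →ₐ[k] MvPolynomial (DegIdx τ m) k).toLinearMap := by
  apply le_antisymm
  · intro G hG
    obtain ⟨F, rfl⟩ := exists_rename_degIdxMap_eq_of_mem_weightSpace hι.injective
      (fun x hx => extend_apply_of_not_mem_range χ hx) (highestWeightSpace_le_weightSpace _ _ hG)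
    exact Submodule.mem_map.mpr ⟨F, mem_highestWeightSpace_of_rename_mem hι hup hG, rfl⟩
  · intro G hG
    obtain ⟨F, hF, rfl⟩ := Submodule.mem_map.mp hG
    exact rename_mem_highestWeightSpace_coordRep hι hup hF

/-- The same for the highest-weight EQUATIONS of the two orbit closures of `p` and `ι(p)`:
`HWV_{χ̂}(k[Sym^m k^τ]) ∩ I(GL_τ · ι(p)) = ι(HWV_χ(k[Sym^m k^σ]) ∩ I(GL_σ · p))`.
[cite: BurgisserEtAl2011, Prop. 6.3.2 (proof)] -/
theorem highestWeightSpace_inf_orbitVanishingIdeal_extend_eq_map [Infinite k] (hι : StrictMono ι)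
    (hup : IsUpperSet (Set.range ι)) (p : MvPolynomial σ k) (χ : Weight σ) :
    highestWeightSpace (coordRep τ k m) (Function.extend ι χ 0) ⊓
        (orbitVanishingIdeal (rename ι p) m).restrictScalars k =
      (highestWeightSpace (coordRep σ k m) χ ⊓ (orbitVanishingIdeal p m).restrictScalars k).map
        (rename (degIdxMap hι.injective) :
          MvPolynomial (DegIdx σ m) k →ₐ[k] MvPolynomial (DegIdx τ m) k).toLinearMap := by
  apply le_antisymm
  · intro G hG
    obtain ⟨hG1, hG2⟩ := Submodule.mem_inf.mp hG
    rw [highestWeightSpace_extend_eq_map hι hup χ] at hG1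
    obtain ⟨F, hF, rfl⟩ := Submodule.mem_map.mp hG1
    refine Submodule.mem_map.mpr ⟨F, Submodule.mem_inf.mpr ⟨hF, ?_⟩, rfl⟩
    rw [Submodule.restrictScalars_mem] at hG2 ⊢
    exact (rename_mem_orbitVanishingIdeal_rename_iff hι.injective p F).mp hG2
  · intro G hG
    obtain ⟨F, hF, rfl⟩ := Submodule.mem_map.mp hG
    obtain ⟨hF1, hF2⟩ := Submodule.mem_inf.mp hF
    refine Submodule.mem_inf.mpr ⟨rename_mem_highestWeightSpace_coordRep hι hup hF1, ?_⟩
    rw [Submodule.restrictScalars_mem] at hF2 ⊢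
    exact (rename_mem_orbitVanishingIdeal_rename_iff hι.injective p F).mpr hF2

end Weights

/-! ### §5 Inheritance of plethysm coefficients and of orbit-closure multiplicities -/

section Multiplicity

variable {m : ℕ}

/-- **Plethysm coefficients are inherited**: for `ι` strictly monotone onto an upper set and any
weight `χ` of `GL_σ`, the multiplicity of the highest weight `χ` extended by zero in
`k[Sym^m k^τ] = ⊕_d Sym^d(Sym^m k^τ)^*` equals that of `χ` in `k[Sym^m k^σ]` (infinite field) — in
partition terms, `mult(S_π W, S^d(S^m W))` does not depend on `dim W ≥ ℓ(π)` ("the realizations of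
`S_π V` in `V^{⊗d}` do not depend on the dimension of `V`", Landsberg 2017 §8.3.3).
[cite: BurgisserEtAl2011, Prop. 6.3.2] -/
theorem plethysmCoeff_extend [Infinite k] (hι : StrictMono ι) (hup : IsUpperSet (Set.range ι))
    (χ : Weight σ) :
    plethysmCoeff k τ m (Function.extend ι χ 0) = plethysmCoeff k σ m χ := by
  unfold plethysmCoeff hwMultiplicity
  rw [highestWeightSpace_extend_eq_map hι hup χ]
  exact (Submodule.equivMapOfInjective _
    (rename_injective _ (degIdxMap_injective hι.injective)) _).finrank_eq.symm

/-- The number of independent highest-weight EQUATIONS of each type is inherited likewise.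
[cite: BurgisserEtAl2011, Prop. 6.3.2] -/
theorem finrank_highestWeightSpace_inf_orbitVanishingIdeal_extend [Infinite k] (hι : StrictMono ι)
    (hup : IsUpperSet (Set.range ι)) (p : MvPolynomial σ k) (χ : Weight σ) :
    Module.finrank k ↥(highestWeightSpace (coordRep τ k m) (Function.extend ι χ 0) ⊓
        (orbitVanishingIdeal (rename ι p) m).restrictScalars k) =
      Module.finrank k ↥(highestWeightSpace (coordRep σ k m) χ ⊓
        (orbitVanishingIdeal p m).restrictScalars k) := by
  rw [highestWeightSpace_inf_orbitVanishingIdeal_extend_eq_map hι hup p χ]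
  exact (Submodule.equivMapOfInjective _
    (rename_injective _ (degIdxMap_injective hι.injective)) _).finrank_eq.symm

/-- **Inheritance of orbit-closure multiplicities (BLMW 2011 Prop. 6.3.2; Mulmuley–Sohoni GCT II
Thm. 8.2(1) for `W = W' ⊕ W''`).** Let `ι : σ → τ` be strictly monotone onto an upper set of
letters (so `k^σ = W' ⊂ W = k^τ` as the span of the greatest `|σ|` coordinates), `p ∈ k[x_σ]` any
polynomial, `m ≠ 0`, characteristic zero. Then for every weight `χ` of `GL_σ` the multiplicity of
`χ` extended by zero in the coordinate ring `k[Δ_m(ι p)] = k[Sym^m k^τ] ⧸ I(GL_τ · ι p)` of the orbit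
closure of `ι(p)` in `Sym^m k^τ` equals the multiplicity of `χ` in `k[Δ_m(p)]`. BLMW: "Let
`W' ⊂ W` be a subspace of dimension `b` and let `f ∈ S^dW'`. Assume that the coordinate ring of the
orbit closure `\overline{GL(W')·f} ⊂ S^dW'` has the `GL(W')`-decomposition
`⊕_{π, ℓ(π) ≤ b} (S_πW'^*)^{m(π)}`. Then the coordinate ring of the orbit closure
`\overline{GL(W)·f} ⊂ S^dW` has the `GL(W)`-decomposition `⊕_{π, ℓ(π) ≤ b} (S_πW^*)^{m(π)}`."
Proof here: `mult + #{independent HW equations} = plethysm coefficient` on both sides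
(`orbitMultiplicity_add_finrank_inf_eq_plethysmCoeff`) and §4–§5. Weights of `GL_τ` NOT of the
form `χ` extended by zero do not occur at all (`apply_eq_zero_of_hasHighestWeight_orbitCoordRep_rename`).
[cite: BurgisserEtAl2011, Prop. 6.3.2] -/
theorem orbitMultiplicity_rename_extend [CharZero k] (hι : StrictMono ι)
    (hup : IsUpperSet (Set.range ι)) (p : MvPolynomial σ k) (hm : m ≠ 0) (χ : Weight σ) :
    orbitMultiplicity k (rename ι p) m (Function.extend ι χ 0) = orbitMultiplicity k p m χ := by
  haveI : Infinite k := CharZero.infinite k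
  have h1 := orbitMultiplicity_add_finrank_inf_eq_plethysmCoeff (rename ι p) hm (Function.extend ι χ 0)
  have h2 := orbitMultiplicity_add_finrank_inf_eq_plethysmCoeff p hm χ
  rw [plethysmCoeff_extend hι hup, finrank_highestWeightSpace_inf_orbitVanishingIdeal_extend hι hup,
    ← h2] at h1
  exact Nat.add_right_cancel h1

/-- Occurrence form: `χ` extended by zero occurs in `k[Δ_m(ι p)]` iff `χ` occurs in `k[Δ_m(p)]`
(`m ≠ 0`, characteristic zero). [cite: BurgisserEtAl2011, Prop. 6.3.2] -/
theorem hasHighestWeight_orbitCoordRep_rename_extend_iff [CharZero k] (hι : StrictMono ι)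
    (hup : IsUpperSet (Set.range ι)) (p : MvPolynomial σ k) (hm : m ≠ 0) (χ : Weight σ) :
    HasHighestWeight (orbitCoordRep (rename ι p) m) (Function.extend ι χ 0) ↔
      HasHighestWeight (orbitCoordRep p m) χ := by
  haveI : Infinite k := CharZero.infinite k
  rw [← orbitMultiplicity_pos_iff_hasHighestWeight _ hm, ← orbitMultiplicity_pos_iff_hasHighestWeight _ hm,
    orbitMultiplicity_rename_extend hι hup p hm χ]

end Multiplicity

/-! ### §6 Weights that are not extended by zero do not occur (BIP Thm. 4.9(1) on `range ι`) -/

section Vanishing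

variable {m : ℕ}

omit [LinearOrder σ] in
/-- **Occurring weights vanish off `range ι`.** If `ψ` is a highest weight of the coordinate ring
`k[Δ_m(ι p)]` of the orbit closure of a renamed polynomial (`ι` injective onto an upper set, `k`
infinite), then `ψ x = 0` for every letter `x ∉ range ι` — the tree's BIP Thm. 4.9(1)
(`apply_eq_zero_of_hasHighestWeight_orbitCoordRep_of_vars_subset`: "`ℓ(λ) ≤ dim W`") with the
bookkeeping `x ∉ range ι ⇒ position(x) + |σ| < |τ|` (all of `range ι` lies above `x`). BLMW:
"`\overline{GL(W)·f} ⊂ Sub_b(S^dW)` so for all partitions `π` with `ℓ(π) > b` …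
`S_πW^* ⊂ I(\overline{GL(W)·f})`". [cite: BurgisserEtAl2011, Prop. 6.3.2 (proof)] -/
theorem apply_eq_zero_of_hasHighestWeight_orbitCoordRep_rename [Infinite k]
    (hι : Function.Injective ι) (hup : IsUpperSet (Set.range ι)) (p : MvPolynomial σ k)
    {ψ : Weight τ} (h : HasHighestWeight (orbitCoordRep (rename ι p) m) ψ) {x : τ}
    (hx : x ∉ Set.range ι) : ψ x = 0 := by
  classical
  set N := Fintype.card τ with hN
  let e : Fin N ≃o τ := monoEquivOfFin τ rfl
  have hA : (↑(rename ι p).vars : Set τ) ⊆ ((Finset.univ.map ⟨ι, hι⟩ : Finset τ) : Set τ) := by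
    intro y hy
    have hy' := vars_rename ι p (Finset.mem_coe.mp hy)
    rw [Finset.mem_image] at hy'
    obtain ⟨j, _, rfl⟩ := hy'
    exact Finset.mem_coe.mpr (Finset.mem_map.mpr ⟨j, Finset.mem_univ j, rfl⟩)
  have hcard : (Finset.univ.map ⟨ι, hι⟩ : Finset τ).card = Fintype.card σ := by
    rw [Finset.card_map, Finset.card_univ]
  have hlt : ((e.symm x : Fin N) : ℕ) + Fintype.card σ < N := by
    let φ : σ → ↥(Finset.Ioi (e.symm x)) := fun s =>
      ⟨e.symm (ι s), Finset.mem_Ioi.mpr (e.symm.strictMono (lt_app_of_not_mem_range hup hx s))⟩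
    have hφ : Function.Injective φ := fun s t hst =>
      hι (e.symm.injective (congrArg (fun u : ↥(Finset.Ioi (e.symm x)) => (u : Fin N)) hst))
    have h1 := Fintype.card_le_of_injective φ hφ
    rw [Fintype.card_coe, Fin.card_Ioi] at h1
    have h2 := (e.symm x).isLt
    omega
  have h0 := apply_eq_zero_of_hasHighestWeight_orbitCoordRep_of_vars_subset e (rename ι p) _ hA h
    (e.symm x) (by rw [hcard]; exact hlt)
  rwa [OrderIso.apply_symm_apply] at h0

omit [LinearOrder σ] in
/-- Hence every weight occurring in `k[Δ_m(ι p)]` is its restriction to `σ` extended by zero.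
[cite: BurgisserEtAl2011, Prop. 6.3.2 (proof)] -/
theorem eq_extend_of_hasHighestWeight_orbitCoordRep_rename [Infinite k]
    (hι : Function.Injective ι) (hup : IsUpperSet (Set.range ι)) (p : MvPolynomial σ k)
    {ψ : Weight τ} (h : HasHighestWeight (orbitCoordRep (rename ι p) m) ψ) :
    ψ = Function.extend ι (ψ ∘ ι) 0 := by
  funext x
  by_cases hx : x ∈ Set.range ι
  · obtain ⟨j, rfl⟩ := hx
    rw [hι.extend_apply]
    rfl
  · rw [apply_eq_zero_of_hasHighestWeight_orbitCoordRep_rename hι hup p h hx,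
      extend_apply_of_not_mem_range _ hx]

omit [LinearOrder σ] in
/-- Multiplicity ZERO for every weight of `GL_τ` that does not vanish off `range ι` (`m ≠ 0`,
infinite field). [cite: BurgisserEtAl2011, Prop. 6.3.2] -/
theorem orbitMultiplicity_rename_eq_zero_of_apply_ne_zero [Infinite k]
    (hι : Function.Injective ι) (hup : IsUpperSet (Set.range ι)) (p : MvPolynomial σ k)
    (hm : m ≠ 0) {ψ : Weight τ} {x : τ} (hx : x ∉ Set.range ι) (hψ : ψ x ≠ 0) :
    orbitMultiplicity k (rename ι p) m ψ = 0 := by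
  by_contra h0
  exact hψ (apply_eq_zero_of_hasHighestWeight_orbitCoordRep_rename hι hup p
    ((orbitMultiplicity_pos_iff_hasHighestWeight _ hm ψ).mp (Nat.pos_of_ne_zero h0)) hx)

/-- **The complete dictionary** (BLMW Prop. 6.3.2, both clauses): for `ι` strictly monotone onto
an upper set, `m ≠ 0`, characteristic zero, and ANY weight `ψ` of `GL_τ`, the multiplicity of `ψ`
in `k[Δ_m(ι p)]` is the multiplicity of `ψ|_σ = ψ ∘ ι` in `k[Δ_m(p)]` if `ψ` vanishes off
`range ι`, and `0` otherwise. [cite: BurgisserEtAl2011, Prop. 6.3.2] -/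
theorem orbitMultiplicity_rename_eq [CharZero k] (hι : StrictMono ι)
    (hup : IsUpperSet (Set.range ι)) (p : MvPolynomial σ k) (hm : m ≠ 0) (ψ : Weight τ) :
    orbitMultiplicity k (rename ι p) m ψ =
      if ∀ x, x ∉ Set.range ι → ψ x = 0 then orbitMultiplicity k p m (ψ ∘ ι) else 0 := by
  haveI : Infinite k := CharZero.infinite k
  split_ifs with hψ
  · have hext : ψ = Function.extend ι (ψ ∘ ι) 0 := by
      funext x
      by_cases hx : x ∈ Set.range ι
      · obtain ⟨j, rfl⟩ := hx
        rw [hι.injective.extend_apply]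
        rfl
      · rw [hψ x hx, extend_apply_of_not_mem_range _ hx]
    rw [hext, orbitMultiplicity_rename_extend hι hup p hm]
    congr 1
    funext j
    simp only [Function.comp_apply, hι.injective.extend_apply]
  · push Not at hψ
    obtain ⟨x, hx, hψx⟩ := hψ
    exact orbitMultiplicity_rename_eq_zero_of_apply_ne_zero hι.injective hup p hm hx hψx

end Vanishing

/-! ### §7 Partition form: `GL_K ⊂ GL_N` on the greatest `K` coordinates -/

section Fin

variable {K N : ℕ}

/-- The order embedding `Fin K → Fin N`, `i ↦ N - K + i`, onto the greatest `K` elements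
(`K ≤ N`). [folklore] -/
def topEmb (hKN : K ≤ N) (i : Fin K) : Fin N :=
  ⟨N - K + i, by have := i.isLt; omega⟩

/-- Values of `topEmb`. [folklore] -/
@[simp]
theorem topEmb_val (hKN : K ≤ N) (i : Fin K) : (topEmb hKN i : ℕ) = N - K + i := rfl

/-- `topEmb` is strictly monotone. [folklore] -/
theorem topEmb_strictMono (hKN : K ≤ N) : StrictMono (topEmb hKN) := fun i j h => by
  rw [Fin.lt_def, topEmb_val, topEmb_val]
  exact Nat.add_lt_add_left (Fin.lt_def.mp h) _

/-- The range of `topEmb` is `{x | N - K ≤ x}`. [folklore] -/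
theorem mem_range_topEmb_iff (hKN : K ≤ N) (x : Fin N) :
    x ∈ Set.range (topEmb hKN) ↔ N - K ≤ (x : ℕ) := by
  constructor
  · rintro ⟨i, rfl⟩
    rw [topEmb_val]
    exact Nat.le_add_right _ _
  · intro hx
    refine ⟨⟨x - (N - K), by have := x.isLt; omega⟩, Fin.ext ?_⟩
    rw [topEmb_val]
    dsimp only
    omega

/-- The range of `topEmb` is an upper set. [folklore] -/
theorem isUpperSet_range_topEmb (hKN : K ≤ N) : IsUpperSet (Set.range (topEmb hKN)) := by
  intro x y hxy hx
  rw [mem_range_topEmb_iff] at hx ⊢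
  exact le_trans hx (Fin.le_iff_val_le_val.mp hxy)

/-- **Dual weights of partitions are extensions by zero**: for `λ` with at most `K ≤ N` parts,
`λ^*` for `GL_N`, i.e. `(0,…,0,-λ_ℓ,…,-λ_1)`, is `λ^*` for `GL_K` extended by zero along
`topEmb`. [folklore] -/
theorem dualOfPartition_eq_extend_topEmb (hKN : K ≤ N) {n : ℕ} (lam : Nat.Partition n)
    (hlam : lam.parts.card ≤ K) :
    Weight.dualOfPartition N lam = Function.extend (topEmb hKN) (Weight.dualOfPartition K lam) 0 := by
  funext x
  by_cases hx : x ∈ Set.range (topEmb hKN)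
  · obtain ⟨i, rfl⟩ := hx
    rw [(topEmb_strictMono hKN).injective.extend_apply]
    simp only [Weight.dualOfPartition, Weight.dual, Weight.ofPartition, Fin.val_rev, topEmb_val]
    congr 3
    have := i.isLt
    omega
  · rw [extend_apply_of_not_mem_range _ hx]
    simp only [Weight.dualOfPartition, Weight.dual, Weight.ofPartition, Fin.val_rev, neg_eq_zero,
      Nat.cast_eq_zero]
    apply List.getD_eq_default
    rw [mem_range_topEmb_iff, not_le] at hx
    have hlen : lam.sortedParts.length = lam.parts.card := by
      simp [Nat.Partition.sortedParts]
    rw [hlen]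
    have := x.isLt
    omega

/-- **Inheritance in partition form (BLMW 2011 Prop. 6.3.2).** Let `p ∈ k[x_1,…,x_K]` and regard it
in `k[x_1,…,x_N]` on the LAST `K` variables (`topEmb`, `K ≤ N`); `m ≠ 0`, characteristic zero. For
every partition `λ` with `ℓ(λ) ≤ K` the multiplicity of the type `λ^*` in the coordinate ring of
the orbit closure `\overline{GL_N · p} ⊂ Sym^m k^N` equals its multiplicity for
`\overline{GL_K · p} ⊂ Sym^m k^K` ("`m(π)` is the same for `W'` and `W`"); types with
`K < ℓ(λ)` have multiplicity `0` (`orbitMultiplicity_rename_eq_zero_of_apply_ne_zero`).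
[cite: BurgisserEtAl2011, Prop. 6.3.2] -/
theorem orbitMultiplicity_rename_topEmb_dualOfPartition [CharZero k] (hKN : K ≤ N)
    (p : MvPolynomial (Fin K) k) {m : ℕ} (hm : m ≠ 0) {n : ℕ} (lam : Nat.Partition n)
    (hlam : lam.parts.card ≤ K) :
    orbitMultiplicity k (rename (topEmb hKN) p) m (Weight.dualOfPartition N lam) =
      orbitMultiplicity k p m (Weight.dualOfPartition K lam) := by
  rw [dualOfPartition_eq_extend_topEmb hKN lam hlam]
  exact orbitMultiplicity_rename_extend (topEmb_strictMono hKN) (isUpperSet_range_topEmb hKN) p hm _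

/-- **Plethysm coefficients do not depend on the number of variables**: for `λ` with at most
`K ≤ N` parts, the multiplicity of `V(λ)^*` in `k[Sym^m k^N]` (i.e. of `V(λ)` in
`⊕_d Sym^d(Sym^m k^N)`) equals that in `k[Sym^m k^K]` (infinite field).
[cite: BurgisserEtAl2011, Prop. 6.3.2] -/
theorem plethysmCoeffOfPartition_eq_of_card_parts_le [Infinite k] (hKN : K ≤ N) (m : ℕ) {n : ℕ}
    (lam : Nat.Partition n) (hlam : lam.parts.card ≤ K) :
    plethysmCoeffOfPartition k N m lam = plethysmCoeffOfPartition k K m lam := by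
  unfold plethysmCoeffOfPartition
  rw [dualOfPartition_eq_extend_topEmb hKN lam hlam]
  exact plethysmCoeff_extend (topEmb_strictMono hKN) (isUpperSet_range_topEmb hKN) _

/-- Occurrence in partition form: for `ℓ(λ) ≤ K ≤ N`, the type `λ^*` occurs in
`k[\overline{GL_N · p}]` iff it occurs in `k[\overline{GL_K · p}]` (`m ≠ 0`, characteristic zero).
[cite: BurgisserEtAl2011, Prop. 6.3.2] -/
theorem hasHighestWeight_orbitCoordRep_rename_topEmb_iff [CharZero k] (hKN : K ≤ N)
    (p : MvPolynomial (Fin K) k) {m : ℕ} (hm : m ≠ 0) {n : ℕ} (lam : Nat.Partition n)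
    (hlam : lam.parts.card ≤ K) :
    HasHighestWeight (orbitCoordRep (rename (topEmb hKN) p) m) (Weight.dualOfPartition N lam) ↔
      HasHighestWeight (orbitCoordRep p m) (Weight.dualOfPartition K lam) := by
  rw [dualOfPartition_eq_extend_topEmb hKN lam hlam]
  exact hasHighestWeight_orbitCoordRep_rename_extend_iff (topEmb_strictMono hKN)
    (isUpperSet_range_topEmb hKN) p hm _

end Fin

/-! ### §8 Any placement of the letters: conjugate forms and the dictionary for arbitrary injections -/

section Placement

variable {m : ℕ}

/-- Forms in one `GL`-orbit have the same orbit, hence literally the same vanishing ideal.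
Mulmuley–Sohoni 2001 §4. [folklore] -/
theorem orbitVanishingIdeal_eq_of_mem_glOrbit {f₁ f₂ : MvPolynomial τ k}
    (h : f₂ ∈ glOrbit τ k f₁) (m : ℕ) : orbitVanishingIdeal f₂ m = orbitVanishingIdeal f₁ m := by
  unfold orbitVanishingIdeal
  rw [glOrbit_eq_of_mem h]

/-- **Multiplicities only depend on the vanishing ideal** (`m ≠ 0`, characteristic zero): by
`mult_χ + dim(HWV_χ ∩ I) = a_χ`. In particular forms in one `GL`-orbit have the same
orbit-closure multiplicities. [folklore] -/
theorem orbitMultiplicity_eq_of_orbitVanishingIdeal_eq [CharZero k] {f₁ f₂ : MvPolynomial τ k}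
    (hm : m ≠ 0) (h : orbitVanishingIdeal f₁ m = orbitVanishingIdeal f₂ m) (ψ : Weight τ) :
    orbitMultiplicity k f₁ m ψ = orbitMultiplicity k f₂ m ψ := by
  have h1 := orbitMultiplicity_add_finrank_inf_eq_plethysmCoeff f₁ hm ψ
  have h2 := orbitMultiplicity_add_finrank_inf_eq_plethysmCoeff f₂ hm ψ
  rw [h, ← h2] at h1
  exact Nat.add_right_cancel h1

/-- Multiplicities are invariant under the `GL`-action on forms: `mult_ψ k[Δ_m(g · f)] = mult_ψ k[Δ_m(f)]`
(same orbit, same orbit closure). Mulmuley–Sohoni 2001 §4. [folklore] -/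
theorem orbitMultiplicity_linSubstRep [CharZero k] (g : GL τ k) (f : MvPolynomial τ k) (hm : m ≠ 0)
    (ψ : Weight τ) : orbitMultiplicity k (linSubstRep τ k g f) m ψ = orbitMultiplicity k f m ψ :=
  orbitMultiplicity_eq_of_orbitVanishingIdeal_eq hm (orbitVanishingIdeal_eq_of_mem_glOrbit ⟨g, rfl⟩ m) ψ

omit [LinearOrder σ] in
/-- **Two placements of the same letters give conjugate forms**: for injections `κ, ι : σ → τ`,
`rename κ p` lies in the `GL_τ`-orbit of `rename ι p` (a permutation `π` of `τ` with `π ∘ ι = κ`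
exists by `Equiv.extendSubtype`; renaming by `π` is the substitution of a permutation matrix,
`linSubst_permMatrix`). [folklore] -/
theorem rename_mem_glOrbit_rename (κ ι : σ → τ) (hκ : Function.Injective κ)
    (hι : Function.Injective ι) (p : MvPolynomial σ k) :
    rename κ p ∈ glOrbit τ k (rename ι p) := by
  classical
  let e : {x // x ∈ Set.range ι} ≃ {x // x ∈ Set.range κ} :=
    (Equiv.ofInjective ι hι).symm.trans (Equiv.ofInjective κ hκ)
  let π : Equiv.Perm τ := e.extendSubtype
  have hπ : ∀ i, π (ι i) = κ i := fun i => by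
    have h1 := Equiv.extendSubtype_apply_of_mem e (ι i) ⟨i, rfl⟩
    rw [h1]
    change ((Equiv.ofInjective κ hκ) ((Equiv.ofInjective ι hι).symm ⟨ι i, ⟨i, rfl⟩⟩) : τ) = κ i
    rw [Equiv.ofInjective_symm_apply]
    rfl
  have hre : rename κ p = rename π (rename ι p) := by
    rw [rename_rename]
    exact congrArg (fun φ : σ → τ => rename φ p) (funext fun i => (hπ i).symm)
  have hdet : (Equiv.Perm.permMatrix k π.symm).det ≠ 0 := by
    rw [Matrix.det_permutation]
    rcases Int.units_eq_one_or (Equiv.Perm.sign π.symm) with h | h <;> simp [h]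
  refine ⟨Matrix.GeneralLinearGroup.mkOfDetNeZero _ hdet, ?_⟩
  dsimp only
  rw [linSubstRep_apply, Matrix.GeneralLinearGroup.val_mkOfDetNeZero, hre, linSubst_permMatrix,
    Equiv.symm_symm]

omit [LinearOrder σ] in
/-- Hence **orbit-closure multiplicities do not depend on the placement**: for injections
`κ, ι : σ → τ`, `k[Δ_m(κ p)]` and `k[Δ_m(ι p)]` have the same multiplicities (`m ≠ 0`,
characteristic zero). [folklore] -/
theorem orbitMultiplicity_rename_eq_rename [CharZero k] (κ ι : σ → τ) (hκ : Function.Injective κ)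
    (hι : Function.Injective ι) (p : MvPolynomial σ k) (hm : m ≠ 0) (ψ : Weight τ) :
    orbitMultiplicity k (rename κ p) m ψ = orbitMultiplicity k (rename ι p) m ψ :=
  orbitMultiplicity_eq_of_orbitVanishingIdeal_eq hm
    (orbitVanishingIdeal_eq_of_mem_glOrbit (rename_mem_glOrbit_rename κ ι hκ hι p) m) ψ

/-- **BLMW Prop. 6.3.2 for an arbitrary placement of the letters.** For ANY injection
`κ : σ → τ` (e.g. the padded permanent's `n² + 1` variables placed anywhere among the `m²` matrix
entries), any reference embedding `ι : σ → τ` strictly monotone onto an upper set, `m ≠ 0`,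
characteristic zero: `mult_{χ extended by zero along ι} k[Δ_m(κ p)] = mult_χ k[Δ_m(p)]`.
[cite: BurgisserEtAl2011, Prop. 6.3.2] -/
theorem orbitMultiplicity_rename_extend_of_injective [CharZero k] (κ : σ → τ)
    (hκ : Function.Injective κ) (hι : StrictMono ι) (hup : IsUpperSet (Set.range ι))
    (p : MvPolynomial σ k) (hm : m ≠ 0) (χ : Weight σ) :
    orbitMultiplicity k (rename κ p) m (Function.extend ι χ 0) = orbitMultiplicity k p m χ := by
  rw [orbitMultiplicity_rename_eq_rename κ ι hκ hι.injective p hm,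
    orbitMultiplicity_rename_extend hι hup p hm]

end Placement

/-! ### §9 Partition form for any placement into a linearly ordered letter type `τ ≃o Fin N`
(e.g. the matrix letters `MatIdx m`, `N = m²`, via the tree's `matIdxEquiv`) -/

section PlacementFin

variable {K N m : ℕ}

omit [Fintype τ] in
/-- Transport of `topEmb` along an order isomorphism `e : Fin N ≃o τ`: strictly monotone with
upper-set range. [folklore] -/
theorem strictMono_comp_topEmb (e : Fin N ≃o τ) (hKN : K ≤ N) :
    StrictMono (fun i => e (topEmb hKN i)) ∧ IsUpperSet (Set.range fun i => e (topEmb hKN i)) := by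
  refine ⟨fun a b hab => e.strictMono (topEmb_strictMono hKN hab), ?_⟩
  rintro x y hxy ⟨a, rfl⟩
  have h1 : topEmb hKN a ≤ e.symm y := by
    have := e.symm.monotone hxy
    rwa [OrderIso.symm_apply_apply] at this
  obtain ⟨b, hb⟩ := isUpperSet_range_topEmb hKN h1 ⟨a, rfl⟩
  exact ⟨b, show e (topEmb hKN b) = y by rw [hb, OrderIso.apply_symm_apply]⟩

omit [Fintype τ] in
/-- The dual weight `λ^*` of `GL_N`, read on `τ` through `e : Fin N ≃o τ` (the tree's
`Weight.toMatIdx` for `τ = MatIdx m`), is `λ^*` of `GL_K` extended by zero along `e ∘ topEmb`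
(`ℓ(λ) ≤ K ≤ N`). [folklore] -/
theorem dualOfPartition_comp_symm_eq_extend (e : Fin N ≃o τ) (hKN : K ≤ N) {n : ℕ}
    (lam : Nat.Partition n) (hlam : lam.parts.card ≤ K) :
    (fun x => Weight.dualOfPartition N lam (e.symm x)) =
      Function.extend (fun i => e (topEmb hKN i)) (Weight.dualOfPartition K lam) 0 := by
  funext x
  rw [dualOfPartition_eq_extend_topEmb hKN lam hlam]
  by_cases hx : e.symm x ∈ Set.range (topEmb hKN)
  · obtain ⟨i, hi⟩ := hx
    have hx' : x = e (topEmb hKN i) := by rw [hi, OrderIso.apply_symm_apply]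
    rw [hx', OrderIso.symm_apply_apply, (topEmb_strictMono hKN).injective.extend_apply,
      ((strictMono_comp_topEmb e hKN).1).injective.extend_apply]
  · rw [extend_apply_of_not_mem_range _ hx, extend_apply_of_not_mem_range]
    rintro ⟨i, rfl⟩
    exact hx ⟨i, (OrderIso.symm_apply_apply e _).symm⟩

/-- **Inheritance, partition form, any placement** (`m ≠ 0`, characteristic zero): let
`κ : Fin K → τ` be ANY injection of letters into a finite linearly ordered letter type with
`e : Fin N ≃o τ` (for the matrix space `τ = MatIdx m`, `N = m²`, `e = matIdxEquiv m`, the weight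
below is the tree's `(Weight.dualOfPartition (m*m) λ).toMatIdx`), `p ∈ k[x_1, …, x_K]`. Then for
every partition `λ` with `ℓ(λ) ≤ K` the multiplicity of the type `λ^*` of `GL_τ` in
`k[\overline{GL_τ · κ(p)}]` equals the multiplicity of the type `λ^*` of `GL_K` in
`k[\overline{GL_K · p}]`. This is exactly how BLMW apply Prop. 6.3.2 to
`ℓ^{n-m} per_m ∈ S^n ℂ^{m²+1} ⊂ S^n ℂ^{n²}`. [cite: BurgisserEtAl2011, Prop. 6.3.2] -/
theorem orbitMultiplicity_rename_dualOfPartition_of_injective [CharZero k] (e : Fin N ≃o τ)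
    (κ : Fin K → τ) (hκ : Function.Injective κ) (p : MvPolynomial (Fin K) k) (hm : m ≠ 0)
    {n : ℕ} (lam : Nat.Partition n) (hlam : lam.parts.card ≤ K) :
    orbitMultiplicity k (rename κ p) m (fun x => Weight.dualOfPartition N lam (e.symm x)) =
      orbitMultiplicity k p m (Weight.dualOfPartition K lam) := by
  have hKN : K ≤ N := by
    have := Fintype.card_le_of_injective κ hκ
    rwa [Fintype.card_fin, ← Fintype.card_congr e.toEquiv, Fintype.card_fin] at this
  rw [dualOfPartition_comp_symm_eq_extend e hKN lam hlam]
  exact orbitMultiplicity_rename_extend_of_injective κ hκ (strictMono_comp_topEmb e hKN).1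
    (strictMono_comp_topEmb e hKN).2 p hm _

/-- Occurrence form of the same. [cite: BurgisserEtAl2011, Prop. 6.3.2] -/
theorem hasHighestWeight_orbitCoordRep_rename_dualOfPartition_iff [CharZero k] (e : Fin N ≃o τ)
    (κ : Fin K → τ) (hκ : Function.Injective κ) (p : MvPolynomial (Fin K) k) (hm : m ≠ 0)
    {n : ℕ} (lam : Nat.Partition n) (hlam : lam.parts.card ≤ K) :
    HasHighestWeight (orbitCoordRep (rename κ p) m) (fun x => Weight.dualOfPartition N lam (e.symm x)) ↔
      HasHighestWeight (orbitCoordRep p m) (Weight.dualOfPartition K lam) := by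
  haveI : Infinite k := CharZero.infinite k
  rw [← orbitMultiplicity_pos_iff_hasHighestWeight _ hm, ← orbitMultiplicity_pos_iff_hasHighestWeight _ hm,
    orbitMultiplicity_rename_dualOfPartition_of_injective e κ hκ p hm lam hlam]

end PlacementFin


end Literature.Computability.AlgebraicComplexity
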